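import Mathlib
import Summits.Ventures.PercRepro2.CutVertexAtoms

/-!
# The cut vertex separating the roots, IX: the separable form of the pieces (blind cell PercRepro2,
p3 g2, 2026-08-25; `proofs/P3-BRIDGE.md` §10.12)

`KB x y z = Σ_{i=1}^{8} c_i φ_{a(i)}(x) φ_{b(i)}(y) φ_{c(i)}(z)` with the twelve per-copy factors
`φ₁ = pd, φ₂ = q, φ₃ = q σ_o σ_b, φ₄ = pd u_o, φ₅ = q σ₃ σ_b, φ₆ = q σ₃ u_o σ_b, φ₇ = q σ_b, φ₈ = q σ_o,
φ₉ = q σ₃, φ₁₀ = q σ₃ u_o, φ₁₁ = pd u_o u_b, φ₁₂ = pd u_b` (`KB_eq_phi`, by `ring`), so the cubic form with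
copy-wise markings factorises term by term (`triple_sum_sep`):
`Wt t₁ t₂ t₃ = Σ_i c_i · Eφ φ_{a(i)} t₁ · Eφ φ_{b(i)} t₂ · Eφ φ_{c(i)} t₃` (`Wt_sep`), with
`Eφ φ t = E[φ(glued(lst x, t))]` — and every `Eφ φ t` is a polynomial of at most eight monomials in the
cluster-event atoms (the lemmas `Ephi_i_T`).  The `l`-state coordinates are read as cluster
indicators by `ite_conn_*` (`conn_side`).  Own work; standard axioms.
-/

namespace Summit.Ventures.PercRepro2

open UnionCluster

namespace CovForm

namespace RootBridge

open OneTyped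

section SepDefs

/-- `φ₁ = pd`. -/
def phi1 (s : St) : ℤ := pdB s
/-- `φ₂ = q`. -/
def phi2 (s : St) : ℤ := qB s
/-- `φ₃ = q σ_o σ_b`. -/
def phi3 (s : St) : ℤ := qB s * (sigB s.Lo s.Ho * sigB s.Lb s.Hb)
/-- `φ₄ = pd u_o`. -/
def phi4 (s : St) : ℤ := pdB s * uB s.Lo s.Ho
/-- `φ₅ = q σ₃ σ_b`. -/
def phi5 (s : St) : ℤ := qB s * (sigB s.L3 s.H3 * sigB s.Lb s.Hb)
/-- `φ₆ = q σ₃ u_o σ_b`. -/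
def phi6 (s : St) : ℤ := qB s * (sigB s.L3 s.H3 * (uB s.Lo s.Ho * sigB s.Lb s.Hb))
/-- `φ₇ = q σ_b`. -/
def phi7 (s : St) : ℤ := qB s * sigB s.Lb s.Hb
/-- `φ₈ = q σ_o`. -/
def phi8 (s : St) : ℤ := qB s * sigB s.Lo s.Ho
/-- `φ₉ = q σ₃`. -/
def phi9 (s : St) : ℤ := qB s * sigB s.L3 s.H3
/-- `φ₁₀ = q σ₃ u_o`. -/
def phi10 (s : St) : ℤ := qB s * (sigB s.L3 s.H3 * uB s.Lo s.Ho)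
/-- `φ₁₁ = pd u_o u_b`. -/
def phi11 (s : St) : ℤ := pdB s * (uB s.Lo s.Ho * uB s.Lb s.Hb)
/-- `φ₁₂ = pd u_b`. -/
def phi12 (s : St) : ℤ := pdB s * uB s.Lb s.Hb

/-- **The kernel is the eight-term sum of products of the per-copy factors.** -/
lemma KB_eq_phi (x y z : St) : KB x y z =
    phi1 x * (phi2 y * phi3 z) + phi2 x * (phi4 y * phi5 z) - phi1 x * (phi2 y * phi6 z) -
      phi1 x * (phi7 y * phi8 z) - phi4 x * (phi7 y * phi9 z) + phi1 x * (phi7 y * phi10 z) -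
      phi1 x * (phi2 y * phi11 z) + phi2 x * (phi12 y * phi4 z) := by
  unfold KB phi1 phi2 phi3 phi4 phi5 phi6 phi7 phi8 phi9 phi10 phi11 phi12
  ring

end SepDefs

section Sep

open Classical

variable {V : Type*} {E : Type*} [Fintype E] [DecidableEq E] {R : Type*} [Field R]
variable (p : E → R) (ends : E → Sym2 V) (o a₁ a₂ a₃ b c : V) (VL VH : Set V)

/-- Linearity of the expectation in the lambda form. -/
lemma expect_add' (f g : Config E → R) : expect p (fun x => f x + g x) = expect p f + expect p g :=
  expect_add p f g

/-- The expectation of one cluster indicator. -/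
lemma expect_iL1 (u v : V) : expect p (fun x => iL ends u v x) = prob p (connEvent ends u v) := by
  rw [prob_eq_expect_indicator]; rfl

/-- The expectation of a product of two cluster indicators. -/
lemma expect_iL2 (u v u' v' : V) :
    expect p (fun x => iL ends u v x * iL ends u' v' x) = prob p (connEvent ends u v ∩ connEvent ends u' v') := by
  rw [prob_eq_expect_indicator]
  congr 1
  funext x
  unfold iL
  rw [indicator_inter_one]

/-- The expectation of a product of three cluster indicators. -/
lemma expect_iL3 (u v u' v' u'' v'' : V) :
    expect p (fun x => iL ends u v x * iL ends u' v' x * iL ends u'' v'' x) =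
      prob p (connEvent ends u v ∩ connEvent ends u' v' ∩ connEvent ends u'' v'') := by
  rw [prob_eq_expect_indicator]
  congr 1
  funext x
  unfold iL
  rw [indicator_inter_one, indicator_inter_one]

/-- The expectation of a per-copy factor at a marking. -/
noncomputable def Eφ (φ : St → ℤ) (t : HState) : R :=
  expect p (fun x => ((φ (gluedSt (lstC ends o a₁ b c VL x) t) : ℤ) : R))

/-- A single separable term of the cubic form. -/
lemma triple_sum_phi (c₀ : R) (φ ψ χ : St → ℤ) (t₁ t₂ t₃ : HState) :
    (∑ x : Config E, ∑ y : Config E, ∑ z : Config E, weight p x * weight p y * weight p z *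
        (c₀ * (((φ (gluedSt (lstC ends o a₁ b c VL x) t₁) : ℤ) : R) *
          (((ψ (gluedSt (lstC ends o a₁ b c VL y) t₂) : ℤ) : R) *
            ((χ (gluedSt (lstC ends o a₁ b c VL z) t₃) : ℤ) : R))))) =
      c₀ * (Eφ p ends o a₁ b c VL φ t₁ * (Eφ p ends o a₁ b c VL ψ t₂ * Eφ p ends o a₁ b c VL χ t₃)) := by
  have key := triple_sum_sep p (fun x => c₀ * ((φ (gluedSt (lstC ends o a₁ b c VL x) t₁) : ℤ) : R))
    (fun y => ((ψ (gluedSt (lstC ends o a₁ b c VL y) t₂) : ℤ) : R))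
    (fun z => ((χ (gluedSt (lstC ends o a₁ b c VL z) t₃) : ℤ) : R))
  rw [expect_const_mul] at key
  unfold Eφ
  calc (∑ x : Config E, ∑ y : Config E, ∑ z : Config E, weight p x * weight p y * weight p z *
        (c₀ * (((φ (gluedSt (lstC ends o a₁ b c VL x) t₁) : ℤ) : R) *
          (((ψ (gluedSt (lstC ends o a₁ b c VL y) t₂) : ℤ) : R) *
            ((χ (gluedSt (lstC ends o a₁ b c VL z) t₃) : ℤ) : R)))))
      = ∑ x : Config E, ∑ y : Config E, ∑ z : Config E, weight p x * weight p y * weight p z *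
        ((c₀ * ((φ (gluedSt (lstC ends o a₁ b c VL x) t₁) : ℤ) : R)) *
          (((ψ (gluedSt (lstC ends o a₁ b c VL y) t₂) : ℤ) : R) *
            ((χ (gluedSt (lstC ends o a₁ b c VL z) t₃) : ℤ) : R))) := by
        refine Finset.sum_congr rfl fun x _ => Finset.sum_congr rfl fun y _ => Finset.sum_congr rfl fun z _ => ?_
        ring
    _ = (c₀ * expect p (fun x => ((φ (gluedSt (lstC ends o a₁ b c VL x) t₁) : ℤ) : R))) *
        (expect p (fun y => ((ψ (gluedSt (lstC ends o a₁ b c VL y) t₂) : ℤ) : R)) *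
          expect p (fun z => ((χ (gluedSt (lstC ends o a₁ b c VL z) t₃) : ℤ) : R))) := key
    _ = c₀ * (expect p (fun x => ((φ (gluedSt (lstC ends o a₁ b c VL x) t₁) : ℤ) : R)) *
        (expect p (fun x => ((ψ (gluedSt (lstC ends o a₁ b c VL x) t₂) : ℤ) : R)) *
          expect p (fun x => ((χ (gluedSt (lstC ends o a₁ b c VL x) t₃) : ℤ) : R)))) := by ring

/-- **The cubic form with copy-wise markings in separable form.** -/
theorem Wt_sep (t₁ t₂ t₃ : HState) :
    Wt p ends o a₁ b c VL t₁ t₂ t₃ =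
      Eφ p ends o a₁ b c VL phi1 t₁ * (Eφ p ends o a₁ b c VL phi2 t₂ * Eφ p ends o a₁ b c VL phi3 t₃) +
      Eφ p ends o a₁ b c VL phi2 t₁ * (Eφ p ends o a₁ b c VL phi4 t₂ * Eφ p ends o a₁ b c VL phi5 t₃) -
      Eφ p ends o a₁ b c VL phi1 t₁ * (Eφ p ends o a₁ b c VL phi2 t₂ * Eφ p ends o a₁ b c VL phi6 t₃) -
      Eφ p ends o a₁ b c VL phi1 t₁ * (Eφ p ends o a₁ b c VL phi7 t₂ * Eφ p ends o a₁ b c VL phi8 t₃) -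
      Eφ p ends o a₁ b c VL phi4 t₁ * (Eφ p ends o a₁ b c VL phi7 t₂ * Eφ p ends o a₁ b c VL phi9 t₃) +
      Eφ p ends o a₁ b c VL phi1 t₁ * (Eφ p ends o a₁ b c VL phi7 t₂ * Eφ p ends o a₁ b c VL phi10 t₃) -
      Eφ p ends o a₁ b c VL phi1 t₁ * (Eφ p ends o a₁ b c VL phi2 t₂ * Eφ p ends o a₁ b c VL phi11 t₃) +
      Eφ p ends o a₁ b c VL phi2 t₁ * (Eφ p ends o a₁ b c VL phi12 t₂ * Eφ p ends o a₁ b c VL phi4 t₃) := by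
  unfold Wt Kt
  set L := lstC ends o a₁ b c VL with hL
  have e : ∀ x y z : Config E, weight p x * weight p y * weight p z *
      ((KB (gluedSt (L x) t₁) (gluedSt (L y) t₂) (gluedSt (L z) t₃) : ℤ) : R) =
      weight p x * weight p y * weight p z * ((1 : R) * (((phi1 (gluedSt (L x) t₁) : ℤ) : R) * (((phi2 (gluedSt (L y) t₂) : ℤ) : R) * ((phi3 (gluedSt (L z) t₃) : ℤ) : R)))) +
      weight p x * weight p y * weight p z * ((1 : R) * (((phi2 (gluedSt (L x) t₁) : ℤ) : R) * (((phi4 (gluedSt (L y) t₂) : ℤ) : R) * ((phi5 (gluedSt (L z) t₃) : ℤ) : R)))) +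
      weight p x * weight p y * weight p z * ((-1 : R) * (((phi1 (gluedSt (L x) t₁) : ℤ) : R) * (((phi2 (gluedSt (L y) t₂) : ℤ) : R) * ((phi6 (gluedSt (L z) t₃) : ℤ) : R)))) +
      weight p x * weight p y * weight p z * ((-1 : R) * (((phi1 (gluedSt (L x) t₁) : ℤ) : R) * (((phi7 (gluedSt (L y) t₂) : ℤ) : R) * ((phi8 (gluedSt (L z) t₃) : ℤ) : R)))) +
      weight p x * weight p y * weight p z * ((-1 : R) * (((phi4 (gluedSt (L x) t₁) : ℤ) : R) * (((phi7 (gluedSt (L y) t₂) : ℤ) : R) * ((phi9 (gluedSt (L z) t₃) : ℤ) : R)))) +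
      weight p x * weight p y * weight p z * ((1 : R) * (((phi1 (gluedSt (L x) t₁) : ℤ) : R) * (((phi7 (gluedSt (L y) t₂) : ℤ) : R) * ((phi10 (gluedSt (L z) t₃) : ℤ) : R)))) +
      weight p x * weight p y * weight p z * ((-1 : R) * (((phi1 (gluedSt (L x) t₁) : ℤ) : R) * (((phi2 (gluedSt (L y) t₂) : ℤ) : R) * ((phi11 (gluedSt (L z) t₃) : ℤ) : R)))) +
      weight p x * weight p y * weight p z * ((1 : R) * (((phi2 (gluedSt (L x) t₁) : ℤ) : R) * (((phi12 (gluedSt (L y) t₂) : ℤ) : R) * ((phi4 (gluedSt (L z) t₃) : ℤ) : R)))) := by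
    intro x y z
    rw [KB_eq_phi]
    push_cast
    ring
  simp only [e, Finset.sum_add_distrib]
  rw [triple_sum_phi, triple_sum_phi, triple_sum_phi, triple_sum_phi, triple_sum_phi, triple_sum_phi,
    triple_sum_phi, triple_sum_phi]
  ring

end Sep

end RootBridge

end CovForm

end Summit.Ventures.PercRepro2
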